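/-
Copyright (c) 2026. All rights reserved.
Released under Apache 2.0 license as described in the file LICENSE.
-/
import Summits.HubbardSuperconductivity.HubbardLadder.Bounds.SectorVarianceBound
import HarnessLib

/-!
# Lower bound on the grand-canonical sum and the explicit off-arc term (bounds.tex §13, D5(c))

HONEST FRAMING: ladder R1–R4 with certified numbers; no claim on H/H₀. These are bounds for
MODEL CLASSES (the typed repulsive/attractive `t–t'` Hubbard torus with a flux twist), no
materials claim.

The bound of Theorem 13_N (#211.8 `norm_ttSectorZ_twist_sub_le`, #211.18/#211.19) contains the
off-arc term `2 z(βU,s)^{|Λ_L|} e^{(F - e^{κ} - κ)|Λ_L|} / Ξ(s)` with the grand-canonical sum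
`Ξ(s) = gcSum (ttSectorWeight L β t' U) n s = |Zc(β,U,s/β; c_0)|` (#211.8
`norm_Zc_ofReal_div_eq_gcSum`) left in the denominator. This part bounds `Ξ(s)` from BELOW by
the Kotecký–Preiss free-energy bound at the REAL fugacity point, where the arc smallness of the
numerator hypotheses already holds (`cos 0 = 1 ≥ c₀`):

* `gcSum_ttSectorWeight_ge` — `z(βU,s)^{|Λ_L|} e^{-a|Λ_L|} ≤ Ξ(s)`: the polymer representation
  `Zc = z₀^{|Λ|} Ξ_poly` (#211.3), `Ξ_poly = exp(log Ξ_poly)` and `‖log Ξ_poly‖ ≤ a|Λ_L|` (#211.10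
  `norm_polymerLogZ_ttActivityMu_le`), with `z₀(β,U,s/β) = z(βU,s) > 0` at the real point;
* `offArcTerm_le` — consequently the off-arc term is at most `2 e^{(F - e^{κ} - κ + a)|Λ_L|}`,
  an EXPLICIT function of the arc/off-arc data: it decays in the volume as soon as
  `F + a < e^{κ} + κ` (`κ = offArcRate c₀ u₀ (βU) s ≥ 0`), a condition on `(β, t', U, s, c₀)` only.

With this part every factor of the Theorem 13_N bound except the walk constant (#211.18/.19,
explicit) and `Re Z_N(0)` (the reference value) is an explicit elementary function of the data;
the successor's node instantiation (D5) needs no further model input for the off-arc term. No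
numerics, no
`native_decide`; standard axioms only. References: R. Kotecký, D. Preiss, Comm. Math. Phys. 103
(1986) 491, Theorem p. 492 [KoteckyPreiss1986]; D. Ueltschi, Analyticity in Hubbard models,
J. Stat. Phys. 95 (1999) 693, §2.3 Prop. 2.2 [Ueltschi1999]; bounds.tex §13.
-/

noncomputable section

namespace Summit.HubbardSuperconductivity.HubbardLadder.Bounds

open Matrix Finset Complex
open Literature.MathematicalPhysics.QuantumLattice
open Literature.Probability.LatticeModels
open scoped ComplexOrder

/-! ### The one-site partition function at the real fugacity point -/

/-- `z₀(β, U, s/β) = z(βU, s)` (real, as a complex number). [this file; #211.11] -/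
theorem atomicPartitionFn_ofReal_div (β U : ℝ) (hβ : β ≠ 0) (s : ℝ) :
    atomicPartitionFn (β : ℂ) (U : ℂ) ((s : ℂ) / β) = ((atomicZ (β * U) s : ℝ) : ℂ) := by
  rw [atomicPartitionFn_div_eq_atomicZC β U hβ, atomicZC_ofReal]

/-- `z₀(β, U, s/β) ≠ 0` at every real fugacity. [this file] -/
theorem atomicPartitionFn_ofReal_div_ne_zero (β U : ℝ) (hβ : β ≠ 0) (s : ℝ) :
    atomicPartitionFn (β : ℂ) (U : ℂ) ((s : ℂ) / β) ≠ 0 := by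
  rw [atomicPartitionFn_ofReal_div β U hβ s]
  exact_mod_cast (atomicZ_pos (β * U) s).ne'

/-- `‖z₀(β, U, s/β)‖ = z(βU, s)`. [this file] -/
theorem norm_atomicPartitionFn_ofReal_div (β U : ℝ) (hβ : β ≠ 0) (s : ℝ) :
    ‖atomicPartitionFn (β : ℂ) (U : ℂ) ((s : ℂ) / β)‖ = atomicZ (β * U) s := by
  rw [atomicPartitionFn_ofReal_div β U hβ s, Complex.norm_real, Real.norm_eq_abs,
    abs_of_pos (atomicZ_pos _ _)]

/-- The site ratio at the real point is at most the arc constant `R` (the real point lies on every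
arc: `cos 0 = 1 ≥ c₀`). [this file; #211.4 `siteRatio_le_of_arc`] -/
theorem siteRatio_ofReal_div_le (β U : ℝ) (hβ : β ≠ 0) (s : ℝ) {c₀ u₀ R : ℝ} (hc₀ : 0 ≤ c₀)
    (hc1 : c₀ ≤ 1) (hv : |β * U| ≤ u₀) (hR : 0 < R)
    (hfloor : 1 ≤ R ^ 2 * (1 - (1 - c₀) / 2 - (1 - c₀ ^ 2) / (1 + Real.exp (-(u₀ / 2))) ^ 2)) :
    siteRatio (β : ℂ) (U : ℂ) ((s : ℂ) / β) ≤ R :=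
  siteRatio_le_of_arc β U hβ (s : ℂ) c₀ u₀ R hc₀
    (by rw [Complex.ofReal_im, Real.cos_zero]; exact hc1) (abs_le.1 hv).1 hR hfloor

/-! ### The lower bound on `Ξ(s)` -/

section Torus

variable {L : ℕ} [NeZero L]

/-- **LOWER BOUND ON THE GRAND-CANONICAL SUM.** For `L ≥ 3`, `β ≠ 0`, arc data `(c₀, u₀, R)` and
Kotecký–Preiss data `(a, δ)` with the smallness `16 s e^{2s} (R e^{a+δ} + a)² ≤ a`
(`s = |β|(1+|t'|)`, exactly the hypotheses of #211.8):
`z(βU,s)^{|Λ_L|} · e^{-a |Λ_L|} ≤ Ξ(s) = gcSum (ttSectorWeight L β t' U) |Orb Λ_L| s`.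
[KoteckyPreiss1986 Theorem p. 492; this file] -/
theorem gcSum_ttSectorWeight_ge (hL : 3 ≤ L) {β : ℝ} (hβ : β ≠ 0) (t' U s : ℝ)
    {c₀ u₀ R a δ : ℝ} (hc₀ : 0 ≤ c₀) (hc1 : c₀ ≤ 1) (hv : |β * U| ≤ u₀) (hR : 0 < R)
    (hfloor : 1 ≤ R ^ 2 * (1 - (1 - c₀) / 2 - (1 - c₀ ^ 2) / (1 + Real.exp (-(u₀ / 2))) ^ 2))
    (ha : 0 < a) (hδ : 0 < δ)
    (hsmall : 16 * (|β| * (1 + |t'|)) * Real.exp (2 * (|β| * (1 + |t'|))) *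
      (R * Real.exp (a + δ) + a) ^ 2 ≤ a) :
    atomicZ (β * U) s ^ Fintype.card (FermionTorus 2 L) *
        Real.exp (-(a * Fintype.card (FermionTorus 2 L))) ≤
      gcSum (ttSectorWeight L β t' U) (Fintype.card (Orb (FermionTorus 2 L))) s := by
  have hz := atomicPartitionFn_ofReal_div_ne_zero β U hβ s
  have hr := siteRatio_ofReal_div_le β U hβ s hc₀ hc1 hv hR hfloor
  have hr0 := siteRatio_nonneg (β : ℂ) (U : ℂ) ((s : ℂ) / β)
  have hsm : 16 * (|β| * (1 + |t'|)) * Real.exp (2 * (|β| * (1 + |t'|))) *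
      (siteRatio (β : ℂ) (U : ℂ) ((s : ℂ) / β) * Real.exp (a + δ) + a) ^ 2 ≤ a :=
    le_trans (mul_le_mul_of_nonneg_left (pow_le_pow_left₀ (by positivity)
      (by nlinarith [Real.exp_pos (a + δ)]) 2) (by positivity)) hsmall
  have h0 := isSmallActivityA_ttActivityMu hL β t' U 0 hz ha hδ hsm
  set ℓ := polymerLogZ polyInc (ttActivityMu L β t' U ((s : ℂ) / β) 0)
    (Finset.univ : Finset (FermionTorus 2 L)).powerset with hℓ
  have hℓle : ‖ℓ‖ ≤ a * Fintype.card (FermionTorus 2 L) :=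
    norm_polymerLogZ_ttActivityMu_le hL β t' U 0 hz ha hδ hsm
  have e0 : Zc (β : ℂ) (U : ℂ) ((s : ℂ) / β) (ttFluxCoupling L β t' 0) =
      atomicPartitionFn (β : ℂ) (U : ℂ) ((s : ℂ) / β) ^ Fintype.card (FermionTorus 2 L) *
        Complex.exp ℓ := by
    rw [Zc_ttFluxCoupling_eq_mul_polymerPartitionFunction_complexMu hL β t' U 0 hz,
      h0.exp_polymerLogZ]
  rw [← norm_Zc_ofReal_div_eq_gcSum hL hβ t' U s, e0, norm_mul, norm_pow,
    norm_atomicPartitionFn_ofReal_div β U hβ s, Complex.norm_exp]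
  refine mul_le_mul_of_nonneg_left (Real.exp_le_exp.2 ?_) (pow_nonneg (atomicZ_pos _ _).le _)
  have h2 := (abs_le.1 ((Complex.abs_re_le_norm ℓ).trans hℓle)).1
  linarith

/-- **THE OFF-ARC TERM OF THEOREM 13_N, EXPLICIT.** Under the hypotheses of
`gcSum_ttSectorWeight_ge`, for every `F`:
`2 z(βU,s)^{|Λ_L|} e^{(F - e^{κ} - κ)|Λ_L|} / Ξ(s) ≤ 2 e^{(F - e^{κ} - κ + a)|Λ_L|}`
(`κ = offArcRate c₀ u₀ (βU) s`). [this file] -/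
theorem offArcTerm_le (hL : 3 ≤ L) {β : ℝ} (hβ : β ≠ 0) (t' U s : ℝ)
    {c₀ u₀ R a δ : ℝ} (hc₀ : 0 ≤ c₀) (hc1 : c₀ ≤ 1) (hv : |β * U| ≤ u₀) (hR : 0 < R)
    (hfloor : 1 ≤ R ^ 2 * (1 - (1 - c₀) / 2 - (1 - c₀ ^ 2) / (1 + Real.exp (-(u₀ / 2))) ^ 2))
    (ha : 0 < a) (hδ : 0 < δ)
    (hsmall : 16 * (|β| * (1 + |t'|)) * Real.exp (2 * (|β| * (1 + |t'|))) *
      (R * Real.exp (a + δ) + a) ^ 2 ≤ a) (F : ℝ) :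
    2 * (atomicZ (β * U) s ^ Fintype.card (FermionTorus 2 L) *
          Real.exp ((F - Real.exp (offArcRate c₀ u₀ (β * U) s) - offArcRate c₀ u₀ (β * U) s) *
            Fintype.card (FermionTorus 2 L))) /
        gcSum (ttSectorWeight L β t' U) (Fintype.card (Orb (FermionTorus 2 L))) s ≤
      2 * Real.exp ((F - Real.exp (offArcRate c₀ u₀ (β * U) s) - offArcRate c₀ u₀ (β * U) s + a) *
        Fintype.card (FermionTorus 2 L)) := by
  have hlow := gcSum_ttSectorWeight_ge hL hβ t' U s hc₀ hc1 hv hR hfloor ha hδ hsmall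
  set Z := atomicZ (β * U) s ^ Fintype.card (FermionTorus 2 L) with hZ
  set X := (F - Real.exp (offArcRate c₀ u₀ (β * U) s) - offArcRate c₀ u₀ (β * U) s) *
    Fintype.card (FermionTorus 2 L) with hX
  have hZ0 : 0 < Z := pow_pos (atomicZ_pos _ _) _
  have hden : 0 < Z * Real.exp (-(a * Fintype.card (FermionTorus 2 L))) :=
    mul_pos hZ0 (Real.exp_pos _)
  calc 2 * (Z * Real.exp X) /
        gcSum (ttSectorWeight L β t' U) (Fintype.card (Orb (FermionTorus 2 L))) s
      ≤ 2 * (Z * Real.exp X) / (Z * Real.exp (-(a * Fintype.card (FermionTorus 2 L)))) :=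
        div_le_div_of_nonneg_left (by positivity) hden hlow
    _ = 2 * Real.exp (X + a * Fintype.card (FermionTorus 2 L)) := by
        rw [Real.exp_add, Real.exp_neg]
        field_simp
    _ = 2 * Real.exp ((F - Real.exp (offArcRate c₀ u₀ (β * U) s) - offArcRate c₀ u₀ (β * U) s + a) *
        Fintype.card (FermionTorus 2 L)) := by
        rw [hX, ← add_mul]

/-- **The off-arc term decays in the volume** as soon as `F + a < e^{κ} + κ`: then
`2 z^{|Λ_L|} e^{(F - e^{κ} - κ)|Λ_L|} / Ξ(s) ≤ 2 e^{-η |Λ_L|}` with `η = e^{κ} + κ - F - a > 0`.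
[this file] -/
theorem offArcTerm_le_exp_neg (hL : 3 ≤ L) {β : ℝ} (hβ : β ≠ 0) (t' U s : ℝ)
    {c₀ u₀ R a δ : ℝ} (hc₀ : 0 ≤ c₀) (hc1 : c₀ ≤ 1) (hv : |β * U| ≤ u₀) (hR : 0 < R)
    (hfloor : 1 ≤ R ^ 2 * (1 - (1 - c₀) / 2 - (1 - c₀ ^ 2) / (1 + Real.exp (-(u₀ / 2))) ^ 2))
    (ha : 0 < a) (hδ : 0 < δ)
    (hsmall : 16 * (|β| * (1 + |t'|)) * Real.exp (2 * (|β| * (1 + |t'|))) *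
      (R * Real.exp (a + δ) + a) ^ 2 ≤ a) {F η : ℝ}
    (hη : η ≤ Real.exp (offArcRate c₀ u₀ (β * U) s) + offArcRate c₀ u₀ (β * U) s - F - a) :
    2 * (atomicZ (β * U) s ^ Fintype.card (FermionTorus 2 L) *
          Real.exp ((F - Real.exp (offArcRate c₀ u₀ (β * U) s) - offArcRate c₀ u₀ (β * U) s) *
            Fintype.card (FermionTorus 2 L))) /
        gcSum (ttSectorWeight L β t' U) (Fintype.card (Orb (FermionTorus 2 L))) s ≤
      2 * Real.exp (-(η * Fintype.card (FermionTorus 2 L))) := by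
  refine (offArcTerm_le hL hβ t' U s hc₀ hc1 hv hR hfloor ha hδ hsmall F).trans ?_
  refine mul_le_mul_of_nonneg_left (Real.exp_le_exp.2 ?_) (by norm_num)
  rw [neg_mul_eq_neg_mul]
  exact mul_le_mul_of_nonneg_right (by linarith) (Nat.cast_nonneg _)

end Torus

end Summit.HubbardSuperconductivity.HubbardLadder.Bounds
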